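import Summits.QuantumFields.BalabanUV.T4Continuum.Support.NE3CovariantSBound
import HarnessLib

/-!
# T⁴ programme, node NE3 — route H♮, row K6-tr «THE DISCRETE COVARIANT TRACE INEQUALITY ON A BLOCK»: the far and near
# `κ`-face values of a direction field against its block interior and its diagonal covariant differences along `κ` —
# `Σ_t ‖η(M•z+t+(M−1)e_κ, κ)‖²_HS ≤ 2·(M⁻¹·Σ_{v∈B}‖η(M•z+v, κ)‖²_HS + M·Σ_{v∈B}‖covFd W η (M•z+v) κ κ‖²_HS)` (any unitary W, no smallness)

NE3 formalisation swarm `b2b-balaban-t4-ne3-formalise-*`, LEAF PROVER 03 (unit `b2b-balaban-t4-ne3-formalise-leaf-03`, gen 8; cell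
`pub-balaban`); NEW small row **K6-tr** of the owner's ruling ρ-g23-3 (journal l.19107) ∕ blueprint `HOME/t4/b2b-balaban-t4-ne3-p1/g23/
D-ne3p1-g23-1.md` §2(b)–(c), §3 («first INTENT wins; leaf-01∕leaf-03 lineages natural»); INTENT ∕ CLAIM journal l.19145.

WHY.  In the K6 assembly (blueprint §2) the remainders of K4-c's covariant block divergence theorem (`farDefect`, `nearDefect`,
`coarseMismatch`) and K4-d2's face-jump pairing `NE3CovariantSBound.abs_sum_hsR_JmpW_le` pair a coarse quantity of block `z` with the
`ℓ¹` sum of the direction field over the far (or near) `κ`-FACE of the block, `Σ_t nhsNorm (η (M•z + t + (M−1)e_κ) κ)`, `t = tbase κ r'`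
transverse.  Passing from the face to the block interior by Cauchy–Schwarz alone costs a bare `M^{1∕2}` — forbidden by SHAPE K4's
CONSTANT TARGET.  The discrete (covariant) TRACE INEQUALITY removes it: a face value is reached from EVERY height `h < M` of its `κ`-line
by `M − 1 − h` covariant `κ`-steps, each an isometry up to the diagonal covariant difference `covFd W η · κ κ` (row NE3-R2's (γ2)
`AveragingDeficitCovGrad.covFd`); averaging over `h` trades the face for `M⁻¹ ×` the block plus `M ×` the diagonal covariant gradient.

CONTENT (all [folklore]; 0 sorry; 0 `def`; any unitary `W` — NO smallness, NO periodicity; face index = K4-c's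
`r' : {j // j ≠ κ} → Fin M` with (69S) `tbase κ r'`, so the consumer pairs it with `farFlux`∕`nearFlux`∕`farDefect`∕`nearDefect` termwise):
§1 `nhsNorm_add_le` (the HS triangle inequality), THE ONE STEP `nhsNorm_succ_le`
   `nhsNorm (η (y + e κ) κ) ≤ nhsNorm (η y κ) + nhsNorm (covFd W η y κ κ)` (`covFd W η y κ κ = Ad (W y κ) (Ad (W (y+e κ) κ) (η (y+e κ) κ) − η y κ)`,
   unitary conjugations are HS isometries) and its iterate `nhsNorm_add_smul_le`
   `nhsNorm (η (y + m•e κ) κ) ≤ nhsNorm (η y κ) + Σ_{j<m} nhsNorm (covFd W η (y + j•e κ) κ κ)`;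
§2 ONE `κ`-LINE `nhsNormSq_top_le_line`: `M·nhsNormSq (η (p + (M−1)•e κ) κ) ≤ 2·Σ_{h<M} nhsNormSq (η (p + h•e κ) κ) + 2·M²·Σ_{j<M} nhsNormSq (covFd W η (p + j•e κ) κ κ)`;
§3 **FAR FACE `sum_nhsNormSq_farFace_le`**: `Σ_{r'} nhsNormSq (η (M•z + tbase κ r' + ((M:ℤ)−1)•e κ) κ)
   ≤ 2·((M:ℝ)⁻¹·Σ_{v∈periodBox M} nhsNormSq (η (M•z+v) κ) + M·Σ_{v∈periodBox M} nhsNormSq (covFd W η (M•z+v) κ κ))` (`sum_periodBox_eq_sum_split`),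
   and its `ℓ¹` form **`sq_sum_nhsNorm_farFace_le`**: `(Σ_{r'} nhsNorm (η (face r') κ))² ≤ 2·(M^{d−2}·Σ_B nhsNormSq η_κ + M^d·Σ_B nhsNormSq (covFd W η · κ κ))`
   (the extra Cauchy–Schwarz over the `M^{d−1}` face sites) — exactly the currency of `abs_sum_hsR_JmpW_le`;
§4 **NEAR FACE, TWO READINGS**: `sum_nhsNormSq_nearFace_le'` — the near face `M•z + t − e_κ` of block `z` IS the far face of block
   `z − e_κ` (§3 verbatim at `z − e_κ`); `sum_nhsNormSq_nearFace_le` — read from block `z`'s OWN interior, with the diagonal covariant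
   differences based one layer lower: `≤ 2·((M:ℝ)⁻¹·Σ_{v∈B} nhsNormSq (η (M•z+v) κ) + M·Σ_{v∈B} nhsNormSq (covFd W η (M•z+v−e κ) κ κ))`.

HONEST FRAMING.  One-dimensional telescoping on OUR typed objects at ONE configuration; no estimate of NE3's; nothing about Bałaban's
minimisers; (P♮)_W, (ML_w) at W ≠ 1, T-E_w and NE3 are NOT proved; spine PROVED 0∕9; finite T⁴ rung (B)+1 — NOT infinite volume, NOT
mass gap, NOT BetaPertH, NOT Clay.  ABSOLUTE RULE kept (nothing printed is a hypothesis; context only: [Balaban1985PropagatorsII] §3,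
localised lower bounds).  PLACEMENT: `Summits/QuantumFields/BalabanUV/`; imports the accepted K4-d2 `NE3CovariantSBound` p230604 only (for `nhsNorm_Ad`; through
it K4-c file 1 `NE3CovariantBlockDivergence` p229606 for `tbase`∕`sum_periodBox_eq_sum_split`, (γ2) `AveragingDeficitCovGrad`, `AveragingDeficitHSInner`).  HONEST DEPENDENCY (cell
page 1): continuum YM on T⁴ ⇐ BetaPertH ∧ nine spine estimates (0/9 proved); BetaPertH ⇐ (D1) ∧ (D4) ∧ CAP+tail; G-an2-4 gates asym,
D1 and NE2/3/4.
-/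

set_option autoImplicit false

open scoped BigOperators Matrix.Norms.L2Operator
open Finset

namespace Summit.QuantumFields.BalabanUV.T4Continuum.NE3CovariantFaceTrace

open Literature.MathematicalPhysics.QuantumFieldTheory.Balaban1983to89
open B7Prop1Explicit B7Prop2Explicit MatrixNorms
open T4AveragingDeficitWall (IsUnitaryCfg Ad)
open T4AveragingDeficitWallBoundary (periodBox mem_periodBox card_periodBox)
open T4AveragingDeficitNonAbelian (Ad_mul Ad_sub)
open AveragingDeficitCovGrad (covFd)
open AveragingDeficitHSInner (hsRe nhsNormSq_Ad nhsNormSq_add abs_hsRe_le)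
open NE3StraightAverageAdjoint (tbase)
open NE3CovariantBlockDivergence (sum_periodBox_eq_sum_split)
open NE3CovariantSBound (nhsNorm_Ad)

noncomputable section

variable {d : ℕ} {n : Type*} [Fintype n] [DecidableEq n]

/-! ## §1 The HS triangle inequality and the covariant one-step along `κ` -/

omit [DecidableEq n] in
/-- The triangle inequality for the normalised Hilbert–Schmidt norm. [folklore] -/
theorem nhsNorm_add_le (X Y : Matrix n n ℂ) : nhsNorm (X + Y) ≤ nhsNorm X + nhsNorm Y := by
  have h := nhsNormSq_add X Y
  have hcs := abs_hsRe_le X Y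
  have hsq : nhsNormSq (X + Y) ≤ (nhsNorm X + nhsNorm Y) ^ 2 := by
    rw [h, add_sq, nhsNorm_sq, nhsNorm_sq]; linarith [le_abs_self (hsRe X Y)]
  calc nhsNorm (X + Y) = Real.sqrt (nhsNormSq (X + Y)) := rfl
    _ ≤ Real.sqrt ((nhsNorm X + nhsNorm Y) ^ 2) := Real.sqrt_le_sqrt hsq
    _ = nhsNorm X + nhsNorm Y := Real.sqrt_sq (add_nonneg (nhsNorm_nonneg X) (nhsNorm_nonneg Y))

omit [DecidableEq n] in
/-- `nhsNorm X ≤ nhsNorm (X − Y) + nhsNorm Y`. [folklore] -/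
theorem nhsNorm_le_nhsNorm_sub_add (X Y : Matrix n n ℂ) : nhsNorm X ≤ nhsNorm (X - Y) + nhsNorm Y := by
  have h := nhsNorm_add_le (X - Y) Y
  rwa [sub_add_cancel] at h

/-- The diagonal covariant difference read in the frame at the end of the first bond:
`covFd W η y κ κ = Ad (W y κ) (Ad (W (y+e κ) κ) (η (y+e κ) κ) − η y κ)`. [folklore] -/
theorem covFd_diag_eq (W : Site d → Fin d → (Matrix n n ℂ)ˣ) (η : Site d → Fin d → Matrix n n ℂ) (y : Site d) (κ : Fin d) :
    covFd W η y κ κ = Ad (W y κ) (Ad (W (y + e κ) κ) (η (y + e κ) κ) - η y κ) := by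
  rw [covFd, Ad_sub, ← Ad_mul]

/-- **THE COVARIANT ONE STEP ALONG `κ`** (unitary `W`): `nhsNorm (η (y + e κ) κ) ≤ nhsNorm (η y κ) + nhsNorm (covFd W η y κ κ)`. [folklore] -/
theorem nhsNorm_succ_le {W : Site d → Fin d → (Matrix n n ℂ)ˣ} (hW : IsUnitaryCfg W) (η : Site d → Fin d → Matrix n n ℂ)
    (y : Site d) (κ : Fin d) : nhsNorm (η (y + e κ) κ) ≤ nhsNorm (η y κ) + nhsNorm (covFd W η y κ κ) := by
  have h1 : nhsNorm (covFd W η y κ κ) = nhsNorm (Ad (W (y + e κ) κ) (η (y + e κ) κ) - η y κ) := by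
    rw [covFd_diag_eq, nhsNorm_Ad (hW _ _)]
  have h2 : nhsNorm (η (y + e κ) κ) = nhsNorm (Ad (W (y + e κ) κ) (η (y + e κ) κ)) := (nhsNorm_Ad (hW _ _) _).symm
  rw [h1, h2]
  have h := nhsNorm_le_nhsNorm_sub_add (Ad (W (y + e κ) κ) (η (y + e κ) κ)) (η y κ)
  linarith

/-- … iterated: `nhsNorm (η (y + m•e κ) κ) ≤ nhsNorm (η y κ) + Σ_{j<m} nhsNorm (covFd W η (y + j•e κ) κ κ)`. [folklore] -/
theorem nhsNorm_add_smul_le {W : Site d → Fin d → (Matrix n n ℂ)ˣ} (hW : IsUnitaryCfg W) (η : Site d → Fin d → Matrix n n ℂ)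
    (y : Site d) (κ : Fin d) :
    ∀ m : ℕ, nhsNorm (η (y + (m : ℤ) • e κ) κ) ≤ nhsNorm (η y κ) + ∑ j ∈ range m, nhsNorm (covFd W η (y + (j : ℤ) • e κ) κ κ)
  | 0 => by simp
  | m + 1 => by
    have ih := nhsNorm_add_smul_le hW η y κ m
    have hstep := nhsNorm_succ_le hW η (y + (m : ℤ) • e κ) κ
    rw [sum_range_succ, show y + ((m + 1 : ℕ) : ℤ) • e κ = y + (m : ℤ) • e κ + e κ by push_cast; rw [add_smul, one_smul, add_assoc]]
    linarith

omit [DecidableEq n] in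
/-- `nhsNorm (−X) = nhsNorm X`. [folklore] -/
theorem nhsNorm_neg (X : Matrix n n ℂ) : nhsNorm (-X) = nhsNorm X := by
  unfold nhsNorm; rw [NE3CovariantCalculus.nhsNormSq_neg]

/-- **THE COVARIANT ONE STEP, BACKWARDS** (unitary `W`): `nhsNorm (η y κ) ≤ nhsNorm (η (y + e κ) κ) + nhsNorm (covFd W η y κ κ)`. [folklore] -/
theorem nhsNorm_le_succ_add {W : Site d → Fin d → (Matrix n n ℂ)ˣ} (hW : IsUnitaryCfg W) (η : Site d → Fin d → Matrix n n ℂ)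
    (y : Site d) (κ : Fin d) : nhsNorm (η y κ) ≤ nhsNorm (η (y + e κ) κ) + nhsNorm (covFd W η y κ κ) := by
  have h1 : nhsNorm (covFd W η y κ κ) = nhsNorm (η y κ - Ad (W (y + e κ) κ) (η (y + e κ) κ)) := by
    rw [covFd_diag_eq, nhsNorm_Ad (hW _ _), ← nhsNorm_neg, neg_sub]
  have h2 : nhsNorm (η (y + e κ) κ) = nhsNorm (Ad (W (y + e κ) κ) (η (y + e κ) κ)) := (nhsNorm_Ad (hW _ _) _).symm
  rw [h1, h2]
  have h := nhsNorm_le_nhsNorm_sub_add (η y κ) (Ad (W (y + e κ) κ) (η (y + e κ) κ))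
  linarith

/-- … iterated backwards: `nhsNorm (η y κ) ≤ nhsNorm (η (y + m•e κ) κ) + Σ_{j<m} nhsNorm (covFd W η (y + j•e κ) κ κ)`. [folklore] -/
theorem nhsNorm_le_add_smul {W : Site d → Fin d → (Matrix n n ℂ)ˣ} (hW : IsUnitaryCfg W) (η : Site d → Fin d → Matrix n n ℂ)
    (y : Site d) (κ : Fin d) :
    ∀ m : ℕ, nhsNorm (η y κ) ≤ nhsNorm (η (y + (m : ℤ) • e κ) κ) + ∑ j ∈ range m, nhsNorm (covFd W η (y + (j : ℤ) • e κ) κ κ)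
  | 0 => by simp
  | m + 1 => by
    have ih := nhsNorm_le_add_smul hW η y κ m
    have hstep := nhsNorm_le_succ_add hW η (y + (m : ℤ) • e κ) κ
    rw [sum_range_succ, show y + ((m + 1 : ℕ) : ℤ) • e κ = y + (m : ℤ) • e κ + e κ by push_cast; rw [add_smul, one_smul, add_assoc]]
    linarith

/-! ## §2 One `κ`-line: the top value against the line and its diagonal covariant differences -/

/-- **ONE `κ`-LINE** (unitary `W`, `M ≥ 1`, base point `p`): `M·nhsNormSq (η (p + (M−1)•e κ) κ) ≤ 2·Σ_{h<M} nhsNormSq (η (p + h•e κ) κ)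
 + 2·M²·Σ_{j<M} nhsNormSq (covFd W η (p + j•e κ) κ κ)` — from EVERY height `h`, `(a + S)² ≤ 2a² + 2S²`, Cauchy–Schwarz on `S`, summed over `h`.
[folklore] -/
theorem nhsNormSq_top_le_line {W : Site d → Fin d → (Matrix n n ℂ)ˣ} (hW : IsUnitaryCfg W) {M : ℕ} (hM : 1 ≤ M)
    (η : Site d → Fin d → Matrix n n ℂ) (p : Site d) (κ : Fin d) :
    (M : ℝ) * nhsNormSq (η (p + ((M : ℤ) - 1) • e κ) κ)
      ≤ 2 * ∑ h ∈ range M, nhsNormSq (η (p + (h : ℤ) • e κ) κ)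
        + 2 * (M : ℝ) ^ 2 * ∑ j ∈ range M, nhsNormSq (covFd W η (p + (j : ℤ) • e κ) κ κ) := by
  set S : ℝ := ∑ j ∈ range M, nhsNorm (covFd W η (p + (j : ℤ) • e κ) κ κ) with hS
  set Q : ℝ := ∑ j ∈ range M, nhsNormSq (covFd W η (p + (j : ℤ) • e κ) κ κ) with hQ
  have hS0 : 0 ≤ S := sum_nonneg fun _ _ => nhsNorm_nonneg _
  have hSQ : S ^ 2 ≤ M * Q := by
    have h := sq_sum_le_card_mul_sum_sq (s := range M) (f := fun j => nhsNorm (covFd W η (p + (j : ℤ) • e κ) κ κ))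
    rw [card_range] at h
    simp only [nhsNorm_sq] at h
    exact_mod_cast h
  -- from every height h < M
  have hfrom : ∀ h ∈ range M, nhsNormSq (η (p + ((M : ℤ) - 1) • e κ) κ) ≤ 2 * nhsNormSq (η (p + (h : ℤ) • e κ) κ) + 2 * S ^ 2 := by
    intro h hh
    rw [mem_range] at hh
    obtain ⟨m, hm⟩ : ∃ m : ℕ, M - 1 = h + m := ⟨M - 1 - h, by omega⟩
    have hiter := nhsNorm_add_smul_le hW η (p + (h : ℤ) • e κ) κ m
    have hpt : p + (h : ℤ) • e κ + (m : ℤ) • e κ = p + ((M : ℤ) - 1) • e κ := by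
      rw [add_assoc, ← add_smul]
      congr 2
      have : ((M : ℤ) - 1) = ((M - 1 : ℕ) : ℤ) := by push_cast [Nat.cast_sub hM]; ring
      rw [this, hm]; push_cast; ring
    rw [hpt] at hiter
    have hpart : ∑ j ∈ range m, nhsNorm (covFd W η (p + (h : ℤ) • e κ + (j : ℤ) • e κ) κ κ) ≤ S := by
      rw [hS]
      have hsub : ∑ j ∈ range m, nhsNorm (covFd W η (p + (h : ℤ) • e κ + (j : ℤ) • e κ) κ κ)
          = ∑ j ∈ Ico h (h + m), nhsNorm (covFd W η (p + (j : ℤ) • e κ) κ κ) := by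
        rw [sum_Ico_eq_sum_range, Nat.add_sub_cancel_left]
        refine sum_congr rfl fun j _ => ?_
        rw [add_assoc, ← add_smul]; push_cast; rfl
      rw [hsub]
      refine sum_le_sum_of_subset_of_nonneg ?_ fun _ _ _ => nhsNorm_nonneg _
      intro j hj
      rw [mem_Ico] at hj; rw [mem_range]; omega
    have ha0 := nhsNorm_nonneg (η (p + (h : ℤ) • e κ) κ)
    have ht0 := nhsNorm_nonneg (η (p + ((M : ℤ) - 1) • e κ) κ)
    have hle : nhsNorm (η (p + ((M : ℤ) - 1) • e κ) κ) ≤ nhsNorm (η (p + (h : ℤ) • e κ) κ) + S := by linarith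
    have hsq := pow_le_pow_left₀ ht0 hle 2
    rw [← nhsNorm_sq, ← nhsNorm_sq]
    nlinarith [hsq, sq_nonneg (nhsNorm (η (p + (h : ℤ) • e κ) κ) - S)]
  have hsum := sum_le_sum hfrom
  rw [sum_const, card_range, nsmul_eq_mul, sum_add_distrib, sum_const, card_range, nsmul_eq_mul, ← mul_sum] at hsum
  have hM0 : (0 : ℝ) ≤ M := Nat.cast_nonneg M
  nlinarith [hsum, hSQ, hM0]

/-- **ONE `κ`-LINE, READ DOWNWARDS** (unitary `W`, any `M`, the near-face site `p` one step below the line `p + e κ, …, p + M•e κ`):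
`M·nhsNormSq (η p κ) ≤ 2·Σ_{h<M} nhsNormSq (η (p + (h+1)•e κ) κ) + 2·M²·Σ_{j<M} nhsNormSq (covFd W η (p + j•e κ) κ κ)`. [folklore] -/
theorem nhsNormSq_bottom_le_line {W : Site d → Fin d → (Matrix n n ℂ)ˣ} (hW : IsUnitaryCfg W) (M : ℕ)
    (η : Site d → Fin d → Matrix n n ℂ) (p : Site d) (κ : Fin d) :
    (M : ℝ) * nhsNormSq (η p κ)
      ≤ 2 * ∑ h ∈ range M, nhsNormSq (η (p + ((h : ℤ) + 1) • e κ) κ)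
        + 2 * (M : ℝ) ^ 2 * ∑ j ∈ range M, nhsNormSq (covFd W η (p + (j : ℤ) • e κ) κ κ) := by
  set S : ℝ := ∑ j ∈ range M, nhsNorm (covFd W η (p + (j : ℤ) • e κ) κ κ) with hS
  set Q : ℝ := ∑ j ∈ range M, nhsNormSq (covFd W η (p + (j : ℤ) • e κ) κ κ) with hQ
  have hS0 : 0 ≤ S := sum_nonneg fun _ _ => nhsNorm_nonneg _
  have hSQ : S ^ 2 ≤ M * Q := by
    have h := sq_sum_le_card_mul_sum_sq (s := range M) (f := fun j => nhsNorm (covFd W η (p + (j : ℤ) • e κ) κ κ))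
    rw [card_range] at h
    simp only [nhsNorm_sq] at h
    exact_mod_cast h
  have hfrom : ∀ h ∈ range M, nhsNormSq (η p κ) ≤ 2 * nhsNormSq (η (p + ((h : ℤ) + 1) • e κ) κ) + 2 * S ^ 2 := by
    intro h hh
    rw [mem_range] at hh
    have hb := nhsNorm_le_add_smul hW η p κ (h + 1)
    have hpart : ∑ j ∈ range (h + 1), nhsNorm (covFd W η (p + (j : ℤ) • e κ) κ κ) ≤ S :=
      sum_le_sum_of_subset_of_nonneg (fun j hj => mem_range.mpr (lt_of_lt_of_le (mem_range.mp hj) (Nat.succ_le_of_lt hh)))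
        fun _ _ _ => nhsNorm_nonneg _
    have hcast : ((h + 1 : ℕ) : ℤ) = (h : ℤ) + 1 := by push_cast; ring
    rw [hcast] at hb
    have ha0 := nhsNorm_nonneg (η (p + ((h : ℤ) + 1) • e κ) κ)
    have ht0 := nhsNorm_nonneg (η p κ)
    have hle : nhsNorm (η p κ) ≤ nhsNorm (η (p + ((h : ℤ) + 1) • e κ) κ) + S := by linarith
    have hsq := pow_le_pow_left₀ ht0 hle 2
    rw [← nhsNorm_sq, ← nhsNorm_sq]
    nlinarith [hsq, sq_nonneg (nhsNorm (η (p + ((h : ℤ) + 1) • e κ) κ) - S)]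
  have hsum := sum_le_sum hfrom
  rw [sum_const, card_range, nsmul_eq_mul, sum_add_distrib, sum_const, card_range, nsmul_eq_mul, ← mul_sum] at hsum
  have hM0 : (0 : ℝ) ≤ M := Nat.cast_nonneg M
  nlinarith [hsum, hSQ, hM0]

/-! ## §3 The far `κ`-face of a block -/

/-- **THE DISCRETE COVARIANT TRACE INEQUALITY, FAR FACE** (unitary `W`, `M ≥ 1`, every `η`, block `z`, direction `κ`):
`Σ_{r'} nhsNormSq (η (M•z + tbase κ r' + ((M:ℤ)−1)•e κ) κ) ≤ 2·((M:ℝ)⁻¹·Σ_{v∈periodBox M} nhsNormSq (η (M•z+v) κ)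
 + M·Σ_{v∈periodBox M} nhsNormSq (covFd W η (M•z+v) κ κ))`. [folklore] -/
theorem sum_nhsNormSq_farFace_le {W : Site d → Fin d → (Matrix n n ℂ)ˣ} (hW : IsUnitaryCfg W) {M : ℕ} (hM : 1 ≤ M)
    (η : Site d → Fin d → Matrix n n ℂ) (z : Site d) (κ : Fin d) :
    ∑ r' : {j : Fin d // j ≠ κ} → Fin M, nhsNormSq (η ((M : ℤ) • z + tbase κ r' + ((M : ℤ) - 1) • e κ) κ)
      ≤ 2 * (((M : ℝ))⁻¹ * ∑ v ∈ periodBox (d := d) M, nhsNormSq (η ((M : ℤ) • z + v) κ)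
          + (M : ℝ) * ∑ v ∈ periodBox (d := d) M, nhsNormSq (covFd W η ((M : ℤ) • z + v) κ κ)) := by
  have hM0 : (0 : ℝ) < M := by exact_mod_cast (by omega : 0 < M)
  set q : Site d := (M : ℤ) • z with hq
  rw [sum_periodBox_eq_sum_split M κ (fun v => nhsNormSq (η (q + v) κ)),
    sum_periodBox_eq_sum_split M κ (fun v => nhsNormSq (covFd W η (q + v) κ κ))]
  have hline : ∀ r' : {j : Fin d // j ≠ κ} → Fin M,
      (M : ℝ) * nhsNormSq (η (q + tbase κ r' + ((M : ℤ) - 1) • e κ) κ)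
        ≤ 2 * ∑ a : Fin M, nhsNormSq (η (q + (tbase κ r' + ((a : ℕ) : ℤ) • e κ)) κ)
          + 2 * (M : ℝ) ^ 2 * ∑ a : Fin M, nhsNormSq (covFd W η (q + (tbase κ r' + ((a : ℕ) : ℤ) • e κ)) κ κ) := by
    intro r'
    have h := nhsNormSq_top_le_line hW hM η (q + tbase κ r') κ
    rw [Fin.sum_univ_eq_sum_range (fun a => nhsNormSq (η (q + (tbase κ r' + (a : ℤ) • e κ)) κ)) M,
      Fin.sum_univ_eq_sum_range (fun a => nhsNormSq (covFd W η (q + (tbase κ r' + (a : ℤ) • e κ)) κ κ)) M]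
    simpa only [add_assoc] using h
  have hsum := sum_le_sum fun r' (_ : r' ∈ (univ : Finset ({j : Fin d // j ≠ κ} → Fin M))) => hline r'
  rw [← mul_sum, sum_add_distrib, ← mul_sum, ← mul_sum] at hsum
  rw [show 2 * ((M : ℝ)⁻¹ * ∑ r' : {j : Fin d // j ≠ κ} → Fin M, ∑ a : Fin M, nhsNormSq (η (q + (tbase κ r' + ((a : ℕ) : ℤ) • e κ)) κ)
      + (M : ℝ) * ∑ r' : {j : Fin d // j ≠ κ} → Fin M, ∑ a : Fin M, nhsNormSq (covFd W η (q + (tbase κ r' + ((a : ℕ) : ℤ) • e κ)) κ κ))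
      = (M : ℝ)⁻¹ * (2 * ∑ r' : {j : Fin d // j ≠ κ} → Fin M, ∑ a : Fin M, nhsNormSq (η (q + (tbase κ r' + ((a : ℕ) : ℤ) • e κ)) κ)
      + 2 * (M : ℝ) ^ 2 * ∑ r' : {j : Fin d // j ≠ κ} → Fin M, ∑ a : Fin M, nhsNormSq (covFd W η (q + (tbase κ r' + ((a : ℕ) : ℤ) • e κ)) κ κ)) by
    field_simp]
  rw [le_inv_mul_iff₀' hM0]
  linarith

/-- The number of sites of a `κ`-face of a block of side `M`: `M^{d−1}`. [folklore] -/
theorem card_face (κ : Fin d) (M : ℕ) : Fintype.card ({j : Fin d // j ≠ κ} → Fin M) = M ^ (d - 1) := by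
  rw [Fintype.card_fun, Fintype.card_fin, Fintype.card_subtype_compl, Fintype.card_fin, Fintype.card_unique]

/-- **THE `ℓ¹` FORM** (the currency of K4-d2's `abs_sum_hsR_JmpW_le`): `(Σ_{r'} nhsNorm (η (M•z + tbase κ r' + (M−1)•e κ) κ))²
 ≤ 2·(M^{d−2}·Σ_{v∈B} nhsNormSq (η (M•z+v) κ) + M^d·Σ_{v∈B} nhsNormSq (covFd W η (M•z+v) κ κ))` — no bare `M^{1∕2}`. [folklore] -/
theorem sq_sum_nhsNorm_farFace_le {W : Site d → Fin d → (Matrix n n ℂ)ˣ} (hW : IsUnitaryCfg W) {M : ℕ} (hM : 1 ≤ M)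
    (η : Site d → Fin d → Matrix n n ℂ) (z : Site d) (κ : Fin d) :
    (∑ r' : {j : Fin d // j ≠ κ} → Fin M, nhsNorm (η ((M : ℤ) • z + tbase κ r' + ((M : ℤ) - 1) • e κ) κ)) ^ 2
      ≤ 2 * ((M : ℝ) ^ (d - 2 : ℤ) * ∑ v ∈ periodBox (d := d) M, nhsNormSq (η ((M : ℤ) • z + v) κ)
          + (M : ℝ) ^ d * ∑ v ∈ periodBox (d := d) M, nhsNormSq (covFd W η ((M : ℤ) • z + v) κ κ)) := by
  have hM0 : (0 : ℝ) < M := by exact_mod_cast (by omega : 0 < M)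
  have hd : 1 ≤ d := Nat.one_le_of_lt (Fin.pos κ)
  have hcs := sq_sum_le_card_mul_sum_sq (s := (univ : Finset ({j : Fin d // j ≠ κ} → Fin M)))
    (f := fun r' => nhsNorm (η ((M : ℤ) • z + tbase κ r' + ((M : ℤ) - 1) • e κ) κ))
  rw [card_univ, card_face] at hcs
  simp only [nhsNorm_sq] at hcs
  have hface := sum_nhsNormSq_farFace_le hW hM η z κ
  have hcard : (((M ^ (d - 1) : ℕ) : ℝ)) = (M : ℝ) ^ (d - 1) := by push_cast; ring
  have hpow1 : (M : ℝ) ^ (d - 1) * (M : ℝ)⁻¹ = (M : ℝ) ^ (d - 2 : ℤ) := by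
    rw [← zpow_natCast, ← zpow_neg_one, ← zpow_add₀ hM0.ne']
    congr 1
    push_cast [Nat.cast_sub hd]; ring
  have hpow2 : (M : ℝ) ^ (d - 1) * (M : ℝ) = (M : ℝ) ^ d := by
    rw [← pow_succ]; congr 1; omega
  have hnn : (0 : ℝ) ≤ (M : ℝ) ^ (d - 1) := by positivity
  calc (∑ r' : {j : Fin d // j ≠ κ} → Fin M, nhsNorm (η ((M : ℤ) • z + tbase κ r' + ((M : ℤ) - 1) • e κ) κ)) ^ 2
      ≤ ((M ^ (d - 1) : ℕ) : ℝ) * ∑ r' : {j : Fin d // j ≠ κ} → Fin M, nhsNormSq (η ((M : ℤ) • z + tbase κ r' + ((M : ℤ) - 1) • e κ) κ) := by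
        exact_mod_cast hcs
    _ ≤ (M : ℝ) ^ (d - 1) * (2 * (((M : ℝ))⁻¹ * ∑ v ∈ periodBox (d := d) M, nhsNormSq (η ((M : ℤ) • z + v) κ)
          + (M : ℝ) * ∑ v ∈ periodBox (d := d) M, nhsNormSq (covFd W η ((M : ℤ) • z + v) κ κ))) := by
        rw [hcard]; exact mul_le_mul_of_nonneg_left hface hnn
    _ = 2 * ((M : ℝ) ^ (d - 2 : ℤ) * ∑ v ∈ periodBox (d := d) M, nhsNormSq (η ((M : ℤ) • z + v) κ)
          + (M : ℝ) ^ d * ∑ v ∈ periodBox (d := d) M, nhsNormSq (covFd W η ((M : ℤ) • z + v) κ κ)) := by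
        rw [← hpow1, ← hpow2]; ring

/-! ## §4 The near `κ`-face of a block, two readings -/

/-- **NEAR FACE = FAR FACE OF THE PREVIOUS BLOCK**: `M•z + t − e_κ = M•(z − e_κ) + t + (M−1)•e_κ`, so
`Σ_{r'} nhsNormSq (η (M•z + tbase κ r' − e κ) κ) ≤ 2·((M:ℝ)⁻¹·Σ_{v∈B} nhsNormSq (η (M•(z−e κ)+v) κ) + M·Σ_{v∈B} nhsNormSq (covFd W η (M•(z−e κ)+v) κ κ))`.
[folklore] -/
theorem sum_nhsNormSq_nearFace_le' {W : Site d → Fin d → (Matrix n n ℂ)ˣ} (hW : IsUnitaryCfg W) {M : ℕ} (hM : 1 ≤ M)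
    (η : Site d → Fin d → Matrix n n ℂ) (z : Site d) (κ : Fin d) :
    ∑ r' : {j : Fin d // j ≠ κ} → Fin M, nhsNormSq (η ((M : ℤ) • z + tbase κ r' - e κ) κ)
      ≤ 2 * (((M : ℝ))⁻¹ * ∑ v ∈ periodBox (d := d) M, nhsNormSq (η ((M : ℤ) • (z - e κ) + v) κ)
          + (M : ℝ) * ∑ v ∈ periodBox (d := d) M, nhsNormSq (covFd W η ((M : ℤ) • (z - e κ) + v) κ κ)) := by
  have h := sum_nhsNormSq_farFace_le hW hM η (z - e κ) κ
  have hsite : ∀ r' : {j : Fin d // j ≠ κ} → Fin M,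
      (M : ℤ) • (z - e κ) + tbase κ r' + ((M : ℤ) - 1) • e κ = (M : ℤ) • z + tbase κ r' - e κ := by
    intro r'; rw [smul_sub, sub_smul, one_smul]; abel
  simpa only [hsite] using h

/-- **NEAR FACE FROM THE BLOCK'S OWN INTERIOR** (diagonal covariant differences based one layer lower, `M•z + v − e_κ`, `v ∈ B`):
`Σ_{r'} nhsNormSq (η (M•z + tbase κ r' − e κ) κ) ≤ 2·((M:ℝ)⁻¹·Σ_{v∈B} nhsNormSq (η (M•z+v) κ) + M·Σ_{v∈B} nhsNormSq (covFd W η (M•z+v−e κ) κ κ))`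
(the near-face value is reached backwards from every height: `η(p − e_κ)` vs `η(p + h•e_κ)` through the bonds at `p − e_κ, …, p + (h−1)e_κ`).
[folklore] -/
theorem sum_nhsNormSq_nearFace_le {W : Site d → Fin d → (Matrix n n ℂ)ˣ} (hW : IsUnitaryCfg W) {M : ℕ} (hM : 1 ≤ M)
    (η : Site d → Fin d → Matrix n n ℂ) (z : Site d) (κ : Fin d) :
    ∑ r' : {j : Fin d // j ≠ κ} → Fin M, nhsNormSq (η ((M : ℤ) • z + tbase κ r' - e κ) κ)
      ≤ 2 * (((M : ℝ))⁻¹ * ∑ v ∈ periodBox (d := d) M, nhsNormSq (η ((M : ℤ) • z + v) κ)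
          + (M : ℝ) * ∑ v ∈ periodBox (d := d) M, nhsNormSq (covFd W η ((M : ℤ) • z + v - e κ) κ κ)) := by
  have hM0 : (0 : ℝ) < M := by exact_mod_cast (by omega : 0 < M)
  set q : Site d := (M : ℤ) • z with hq
  rw [sum_periodBox_eq_sum_split M κ (fun v => nhsNormSq (η (q + v) κ)),
    sum_periodBox_eq_sum_split M κ (fun v => nhsNormSq (covFd W η (q + v - e κ) κ κ))]
  -- one κ-line, read downwards from the near-face site `p = q + t − e κ`
  have hline : ∀ r' : {j : Fin d // j ≠ κ} → Fin M,
      (M : ℝ) * nhsNormSq (η (q + tbase κ r' - e κ) κ)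
        ≤ 2 * ∑ a : Fin M, nhsNormSq (η (q + (tbase κ r' + ((a : ℕ) : ℤ) • e κ)) κ)
          + 2 * (M : ℝ) ^ 2 * ∑ a : Fin M, nhsNormSq (covFd W η (q + (tbase κ r' + ((a : ℕ) : ℤ) • e κ) - e κ) κ κ) := by
    intro r'
    have h := nhsNormSq_bottom_le_line hW M η (q + tbase κ r' - e κ) κ
    have hidx1 : ∑ h ∈ range M, nhsNormSq (η (q + tbase κ r' - e κ + ((h : ℤ) + 1) • e κ) κ)
        = ∑ a : Fin M, nhsNormSq (η (q + (tbase κ r' + ((a : ℕ) : ℤ) • e κ)) κ) := by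
      rw [Fin.sum_univ_eq_sum_range (fun a => nhsNormSq (η (q + (tbase κ r' + (a : ℤ) • e κ)) κ)) M]
      refine sum_congr rfl fun h _ => ?_
      rw [add_smul, one_smul]; congr 2; abel
    have hidx2 : ∑ j ∈ range M, nhsNormSq (covFd W η (q + tbase κ r' - e κ + (j : ℤ) • e κ) κ κ)
        = ∑ a : Fin M, nhsNormSq (covFd W η (q + (tbase κ r' + ((a : ℕ) : ℤ) • e κ) - e κ) κ κ) := by
      rw [Fin.sum_univ_eq_sum_range (fun a => nhsNormSq (covFd W η (q + (tbase κ r' + (a : ℤ) • e κ) - e κ) κ κ)) M]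
      refine sum_congr rfl fun j _ => ?_
      congr 2; abel
    rw [hidx1, hidx2] at h
    exact h
  have hsum := sum_le_sum fun r' (_ : r' ∈ (univ : Finset ({j : Fin d // j ≠ κ} → Fin M))) => hline r'
  rw [← mul_sum, sum_add_distrib, ← mul_sum, ← mul_sum] at hsum
  rw [show 2 * ((M : ℝ)⁻¹ * ∑ r' : {j : Fin d // j ≠ κ} → Fin M, ∑ a : Fin M, nhsNormSq (η (q + (tbase κ r' + ((a : ℕ) : ℤ) • e κ)) κ)
      + (M : ℝ) * ∑ r' : {j : Fin d // j ≠ κ} → Fin M, ∑ a : Fin M, nhsNormSq (covFd W η (q + (tbase κ r' + ((a : ℕ) : ℤ) • e κ) - e κ) κ κ))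
      = (M : ℝ)⁻¹ * (2 * ∑ r' : {j : Fin d // j ≠ κ} → Fin M, ∑ a : Fin M, nhsNormSq (η (q + (tbase κ r' + ((a : ℕ) : ℤ) • e κ)) κ)
      + 2 * (M : ℝ) ^ 2 * ∑ r' : {j : Fin d // j ≠ κ} → Fin M, ∑ a : Fin M, nhsNormSq (covFd W η (q + (tbase κ r' + ((a : ℕ) : ℤ) • e κ) - e κ) κ κ)) by
    field_simp]
  rw [le_inv_mul_iff₀' hM0]
  linarith

end

end Summit.QuantumFields.BalabanUV.T4Continuum.NE3CovariantFaceTrace
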